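import Mathlib
import Literature.MathematicalPhysics.QuantumFieldTheory.Balaban1983to89.B9Eq3152
import Literature.MathematicalPhysics.QuantumFieldTheory.Balaban1983to89.B6

/-!
# `Balaban1983to89.B9Delta2Def134` — T. Bałaban, *Propagators for lattice gauge theories in a background field*, Commun. Math. Phys. **99** (1985) 389–434 [Balaban1985BackgroundPropagators]: Sect. D, pp. 422–423 — the operator Δ⁽²⁾ of (3.134), Δ⁽²⁾_π of (3.135), the representation (3.136) and the bounds (3.137), TYPED over the Sect.-D matrix carriers, with (3.134)–(3.136) PROVED as operator identities and the two printed "hence" steps of (3.137) PROVED from named hypotheses of the printed shape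

statement-level skeleton of published theorems with citation tags; proofs where landed; nothing here is a claim about the Yang–Mills mass gap

PDF held: `paper:balaban1985-cmp99-background-propagators` (journal page = PDF page + 388); pp. 421–423 [PDF 33–35]
read from the page renders `run/shared/lean/pub/pub-balaban/b2b-balaban-ref1/pages/1985-cmp99-background-propagators/
…-p033-x2.png`, `…-p034-x2.png`, `…-p035-x2.png` (read as images).

WHAT IS REPRODUCED.  SKELETON row `B9.Eq3.134` (= (3.134)–(3.137); lit-balaban Phase-2 re-point G.5-17 of seat p10;
row owner r06; before this file: `absent` — *"explicitly listed as NOT reproduced in `B9SectDSup`; enters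
`B9SectDL2Decay`/`B9SectDSup` only as a block-bounded perturbation hypothesis"*).  Printed text, p. 422 [PDF 34]:
*"To get similar results for G₁, H₁, we have to investigate the operator determined by the second quadratic form on
the right-hand side of (3.128). Let us define ⟨A,Δ⁽²⁾A⟩ = 2⟨HC⁽²⁾(A),J⟩. (3.134) A meaning of Δ⁽²⁾_π is obvious, it
defines the second quadratic form in (3.128), i.e. we have
Δ⁽²⁾_π = Δ⁽²⁾ − DRG′D\*Δ⁽²⁾ − Δ⁽²⁾DG′RD\* + DRG′D\*Δ⁽²⁾DG′RD\*. (3.135) To find bounds for the operator Δ⁽²⁾ let us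
write it in the form Δ⁽²⁾A = Σ_{j=1}^{k} Σ_{b∈Λ_j} (L^jη)^{d+1} tr (δ/δA) C_j⁽²⁾(A,b)(H\*J)(b). (3.136) From the regularity
condition (3.36) and the inequality (3.133) we have the estimate |(H\*J)(b)| ≤ O(1)Mα₀(L^jη)⁻³ for b ∈ Λ_j. The
inequality (149) in [5] implies |⟨δA,Δ⁽²⁾A⟩| ≤ O(1)C₃Mα₀ Σ_{j=0}^{k} Σ_{b∈Λ_j} (L^jη)^{d−2}(Q″_j|δA|)(c)|A|_c,"* p. 423
[PDF 35]: *"hence |(Δ⁽²⁾A)(b)| ≤ O(1)Mα₀(L^jη)⁻²|A|, b ∈ Δ(y), y ∈ Λ_j, (3.137) and the supremum |A| is taken over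
several j-blocks surrounding Δ(y). This bound implies that the operators Δ⁽²⁾, Δ⁽²⁾_π are small in a proper sense, if
α₀ is sufficiently small."*

CARRIERS (no new carrier).  The Sect.-D matrix vocabulary of `B9SectDFP` / `B9Eq3152` (cell pub-balaban, B09): finite
index types, bond configurations `A : b → ℝ`, `⟨·,·⟩ ↦ ⬝ᵥ`, `* ↦ ᵀ`; `T = 1 − DG′RD*` = `B9SectDFP.tOp Δ Q a D`
(`G′`, `R` = `B9H163.G'`, `B9H163.R`), `Δ_π = TᵀKT` = `B9SectDFP.piOp`, `G⁻¹` of (3.122) = `B9SectDFP.Ginv`, `G₁⁻¹` of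
(3.128) = `B9Eq3152.G1inv K 𝒞 …` where — `B9Eq3152` modelling note (b) — `𝒞 : Matrix b b ℝ` is the matrix of the
quadratic form `A ↦ ⟨HC⁽²⁾(A),J⟩` (C⁽²⁾ quadratic in A, H linear, J fixed).  In this vocabulary (3.134) DEFINES
`Δ⁽²⁾ = 𝒞 + 𝒞ᵀ` (the symmetric operator of the form 2Aᵀ𝒞A; `delta2`, `eq_3134`, uniqueness `delta2_unique`), (3.135)
is `Δ⁽²⁾_π = TᵀΔ⁽²⁾T` expanded (`delta2pi`, `eq_3135`, and `delta2pi_quadForm` = *"it defines the second quadratic form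
in (3.128)"*, `G1inv_quadForm` / `G1inv_eq_Ginv_sub` = `⟨A,G₁⁻¹A⟩ = ⟨A,G⁻¹A⟩ − ⟨A,Δ⁽²⁾_πA⟩`, the input of (3.138)),
and (3.136) is the statement that `Δ⁽²⁾A` is the A-gradient of `⟨C⁽²⁾(A),H*J⟩ = ⟨HC⁽²⁾(A),J⟩` (`eq_3136_dir`: the
directional derivative `d/dt ⟨A+tδA, 𝒞(A+tδA)⟩|₀ = ⟨δA,Δ⁽²⁾A⟩`; `eq_3136`: componentwise; `eq_3136_sum`: for 𝒞 a
weighted sum `Σ_k w_k M_k` of bond terms — the printed `Σ_j Σ_{b∈Λ_j} (L^jη)^{d+1} tr[C_j⁽²⁾(A,b)(H*J)(b)]`, one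
quadratic form `Aᵀ M_k A` per (bond, component), weight `(L^jη)^{d+1}` — `Δ⁽²⁾A = Σ_k w_k ∇_A(AᵀM_kA)`).  (3.137) is
typed over the multiscale geometry `B6.Geometry` (𝔅 = ⋃Λ_j, `g.len y = L^jη`, `g.dist`) as the two printed shapes
`Ineq3137a` (|(H*J)(b)| ≤ O(1)Mα₀(L^jη)⁻³) and `Ineq3137b` (|(Δ⁽²⁾A)(b)| ≤ O(1)Mα₀(L^jη)⁻²|A|), and the two printed
"hence" steps are PROVED from hypotheses of the printed shape, each named after its printed source:
`ineq3137a_of_3133_336` ((3.133) summed over blocks + (3.36) via (3.11) + the scale-sum of [4] Lemma 2.1) and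
`ineq3137b_of_149` (the displayed consequence of [5] (149), tested against δA = a unit bond configuration).
DELIBERATELY NOT HERE (remain hypotheses of printed shape, as in `B9SectDSup`): the objects C_j⁽²⁾, H, J, Q″_j
themselves on the lattice T_η and the derivations of (3.133), of the (149)-display from [5] Prop. 5, and of the
Lemma-2.1 scale sum; the smallness conclusion *"small in a proper sense"* (it is `B9SectDSup`/`B9SectDL2Decay`'s
block-majorant input).  READING NOTES: (3.136) sums `j = 1,…,k`, the (149)-display `j = 0,…,k` (as printed); Theorem
3.12's "(1.133)" means (3.133) (cell flag F-1.133).  Nothing of the series is asserted; kernel-checked finite-dimensional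
algebra/calculus, every hypothesis displayed, standard axioms.  Unit `lit-balaban-p10`, HOME
`run/shared/lean/pub/lit-balaban/`.
-/

namespace Literature.MathematicalPhysics.QuantumFieldTheory.Balaban1983to89.B9Delta2Def134

open Matrix
open scoped Matrix
open Literature.MathematicalPhysics.QuantumFieldTheory.Balaban1983to89

noncomputable section

variable {n m b q : Type*}

/-! ## §1. (3.134): the operator Δ⁽²⁾ of the quadratic form `2⟨HC⁽²⁾(A),J⟩` -/

/-- **(3.134)** p. 422 [PDF 34], verbatim: *"Let us define ⟨A,Δ⁽²⁾A⟩ = 2⟨HC⁽²⁾(A),J⟩."* — typed reading over the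
Sect.-D matrix carrier (`B9Eq3152` note (b): `𝒞` = the matrix of the quadratic form `A ↦ ⟨HC⁽²⁾(A),J⟩`): Δ⁽²⁾ is THE
symmetric operator of the form `2Aᵀ𝒞A`, i.e. `Δ⁽²⁾ = 𝒞 + 𝒞ᵀ`. [cite: Balaban1985BackgroundPropagators, (3.134) p.422] -/
def delta2 (C : Matrix b b ℝ) : Matrix b b ℝ := C + Cᵀ

/-- Δ⁽²⁾ is symmetric. [cite: Balaban1985BackgroundPropagators, (3.134) p.422] -/
theorem delta2_transpose (C : Matrix b b ℝ) : (delta2 C)ᵀ = delta2 C := by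
  rw [delta2, transpose_add, transpose_transpose, add_comm]

/-- For a symmetric `𝒞`, `Δ⁽²⁾ = 2𝒞`. [cite: Balaban1985BackgroundPropagators, (3.134) p.422] -/
theorem delta2_of_symm (C : Matrix b b ℝ) (hC : Cᵀ = C) : delta2 C = (2 : ℝ) • C := by
  rw [delta2, hC, two_smul]

/-- **(3.134) as printed**: `⟨A,Δ⁽²⁾A⟩ = 2⟨HC⁽²⁾(A),J⟩` (= `2·Aᵀ𝒞A`). [cite: Balaban1985BackgroundPropagators, (3.134) p.422] -/
theorem eq_3134 [Fintype b] (C : Matrix b b ℝ) (A : b → ℝ) :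
    A ⬝ᵥ delta2 C *ᵥ A = 2 * (A ⬝ᵥ C *ᵥ A) := by
  rw [delta2, add_mulVec, dotProduct_add, mulVec_transpose, dotProduct_comm A (A ᵥ* C), ← dotProduct_mulVec]
  ring

/-- *"it defines"*: a SYMMETRIC operator is determined by its quadratic form — any symmetric `S` with
`⟨A,SA⟩ = 2⟨HC⁽²⁾(A),J⟩` for all `A` is Δ⁽²⁾ (polarisation). [cite: Balaban1985BackgroundPropagators, (3.134) p.422] -/
theorem delta2_unique [Fintype b] [DecidableEq b] (C S : Matrix b b ℝ) (hS : Sᵀ = S)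
    (h : ∀ A : b → ℝ, A ⬝ᵥ S *ᵥ A = 2 * (A ⬝ᵥ C *ᵥ A)) : S = delta2 C := by
  have key : ∀ A : b → ℝ, A ⬝ᵥ S *ᵥ A = A ⬝ᵥ delta2 C *ᵥ A := fun A => by rw [h, eq_3134]
  have polar : ∀ (T : Matrix b b ℝ), Tᵀ = T → ∀ i j : b,
      (Pi.single i 1 + Pi.single j 1) ⬝ᵥ T *ᵥ (Pi.single i 1 + Pi.single j 1)
        - Pi.single i 1 ⬝ᵥ T *ᵥ Pi.single i 1 - Pi.single j 1 ⬝ᵥ T *ᵥ Pi.single j 1 = 2 * T i j := by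
    intro T hT i j
    have hji : T j i = T i j := by
      have e := congrFun (congrFun hT i) j
      rwa [transpose_apply] at e
    simp only [mulVec_add, dotProduct_add, add_dotProduct, mulVec_single_one, single_one_dotProduct, col_apply]
    linarith
  ext i j
  have h1 := polar S hS i j
  have h2 := polar (delta2 C) (delta2_transpose C) i j
  rw [key, key, key] at h1
  linarith

/-! ## §2. (3.135): Δ⁽²⁾_π = TᵀΔ⁽²⁾T, `T = 1 − DG′RD*`, and its place in (3.128)/(3.138) -/

section Pi

variable [Fintype n] [Fintype m] [Fintype b] [DecidableEq n] [DecidableEq m] [DecidableEq b]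

/-- **Δ⁽²⁾_π** p. 422: *"A meaning of Δ⁽²⁾_π is obvious, it defines the second quadratic form in (3.128)"* — the
matrix `TᵀΔ⁽²⁾T` of `A ↦ 2⟨HC⁽²⁾(A − DG′RD*A),J⟩`, `T = 1 − DG′RD*` = `B9SectDFP.tOp`.
[cite: Balaban1985BackgroundPropagators, (3.135) p.422] -/
def delta2pi (C : Matrix b b ℝ) (Δ : Matrix n n ℝ) (Q : Matrix m n ℝ) (a : ℝ) (D : Matrix b n ℝ) :
    Matrix b b ℝ :=
  B9SectDFP.piOp (delta2 C) Δ Q a D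

/-- *"it defines the second quadratic form in (3.128)"*: `⟨A,Δ⁽²⁾_πA⟩ = 2⟨TA, 𝒞·TA⟩ = 2⟨HC⁽²⁾(A − DG′RD*A),J⟩`
(cf. `B9Eq3152.eq_3128`, whose second term is `−2⟨TA,𝒞·TA⟩`). [cite: Balaban1985BackgroundPropagators, (3.135) p.422] -/
theorem delta2pi_quadForm (C : Matrix b b ℝ) (Δ : Matrix n n ℝ) (Q : Matrix m n ℝ) (a : ℝ) (D : Matrix b n ℝ)
    (A : b → ℝ) :
    A ⬝ᵥ delta2pi C Δ Q a D *ᵥ A =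
      2 * ((B9SectDFP.tOp Δ Q a D *ᵥ A) ⬝ᵥ C *ᵥ (B9SectDFP.tOp Δ Q a D *ᵥ A)) := by
  rw [delta2pi, B9SectDFP.piOp_quadForm, eq_3134]

omit [Fintype b] in
/-- `Tᵀ = 1 − DRG′D*` (`R`, `G′` symmetric for symmetric `Δ`). [cite: Balaban1985BackgroundPropagators, (3.135) p.422] -/
theorem tOp_transpose (Δ : Matrix n n ℝ) (Q : Matrix m n ℝ) (a : ℝ) (D : Matrix b n ℝ) (hΔ : Δ.IsSymm) :
    (B9SectDFP.tOp Δ Q a D)ᵀ = 1 - D * B9H163.R Δ Q a * B9H163.G' Δ Q a * Dᵀ := by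
  rw [B9SectDFP.tOp, transpose_sub, transpose_one, transpose_mul, transpose_mul, transpose_mul,
    transpose_transpose, B9SectECov.R_transpose Δ Q a hΔ, (B9H163.G'_isSymm (Q := Q) (a := a) hΔ).eq,
    ← Matrix.mul_assoc, ← Matrix.mul_assoc]

/-- **(3.135) as printed**: `Δ⁽²⁾_π = Δ⁽²⁾ − DRG′D*Δ⁽²⁾ − Δ⁽²⁾DG′RD* + DRG′D*Δ⁽²⁾DG′RD*`.
[cite: Balaban1985BackgroundPropagators, (3.135) p.422] -/
theorem eq_3135 (C : Matrix b b ℝ) (Δ : Matrix n n ℝ) (Q : Matrix m n ℝ) (a : ℝ) (D : Matrix b n ℝ)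
    (hΔ : Δ.IsSymm) :
    delta2pi C Δ Q a D =
      delta2 C - D * B9H163.R Δ Q a * B9H163.G' Δ Q a * Dᵀ * delta2 C
        - delta2 C * (D * B9H163.G' Δ Q a * B9H163.R Δ Q a * Dᵀ)
        + D * B9H163.R Δ Q a * B9H163.G' Δ Q a * Dᵀ * delta2 C *
            (D * B9H163.G' Δ Q a * B9H163.R Δ Q a * Dᵀ) := by
  rw [delta2pi, B9SectDFP.piOp, tOp_transpose Δ Q a D hΔ, B9SectDFP.tOp]
  simp only [Matrix.sub_mul, Matrix.mul_sub, Matrix.one_mul, Matrix.mul_one]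
  abel

/-- `G₁⁻¹ = G⁻¹ − 2TᵀCT` as matrices, `G⁻¹` = (3.122)'s `B9SectDFP.Ginv K`, `G₁⁻¹` = (3.128)'s `B9Eq3152.G1inv K 𝒞`
(no symmetry needed). [cite: Balaban1985BackgroundPropagators, (3.128) p.421] -/
theorem G1inv_eq_Ginv_sub_two_piOp (K C : Matrix b b ℝ) (Δ : Matrix n n ℝ) (Q : Matrix m n ℝ) (a : ℝ)
    (D : Matrix b n ℝ) [Fintype q] (Qb : Matrix q b ℝ) (ab : ℝ) :
    B9Eq3152.G1inv K C Δ Q a D Qb ab =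
      B9SectDFP.Ginv K Δ Q a D Qb ab - (2 : ℝ) • B9SectDFP.piOp C Δ Q a D := by
  rw [B9Eq3152.G1inv_eq, B9SectDFP.Ginv]
  abel

/-- For symmetric `𝒞`: `Δ⁽²⁾_π = 2Tᵀ𝒞T` and **`G₁⁻¹ = G⁻¹ − Δ⁽²⁾_π`** — the form in which Δ⁽²⁾_π enters (3.138)
`G₁ = G₀(I − (Δ′_π + Δ⁽²⁾_π)G₀)⁻¹`. [cite: Balaban1985BackgroundPropagators, (3.135) p.422] -/
theorem G1inv_eq_Ginv_sub (K C : Matrix b b ℝ) (hC : Cᵀ = C) (Δ : Matrix n n ℝ) (Q : Matrix m n ℝ) (a : ℝ)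
    (D : Matrix b n ℝ) [Fintype q] (Qb : Matrix q b ℝ) (ab : ℝ) :
    B9Eq3152.G1inv K C Δ Q a D Qb ab = B9SectDFP.Ginv K Δ Q a D Qb ab - delta2pi C Δ Q a D := by
  rw [G1inv_eq_Ginv_sub_two_piOp, delta2pi, delta2_of_symm C hC, B9SectDFP.piOp, B9SectDFP.piOp,
    Matrix.mul_smul, Matrix.smul_mul]

/-- For ANY `𝒞`: `⟨A,G₁⁻¹A⟩ = ⟨A,G⁻¹A⟩ − ⟨A,Δ⁽²⁾_πA⟩` — (3.128) read through (3.134)–(3.135).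
[cite: Balaban1985BackgroundPropagators, (3.135) p.422] -/
theorem G1inv_quadForm (K C : Matrix b b ℝ) (Δ : Matrix n n ℝ) (Q : Matrix m n ℝ) (a : ℝ) (D : Matrix b n ℝ)
    [Fintype q] (Qb : Matrix q b ℝ) (ab : ℝ) (A : b → ℝ) :
    A ⬝ᵥ B9Eq3152.G1inv K C Δ Q a D Qb ab *ᵥ A =
      A ⬝ᵥ B9SectDFP.Ginv K Δ Q a D Qb ab *ᵥ A - A ⬝ᵥ delta2pi C Δ Q a D *ᵥ A := by
  rw [G1inv_eq_Ginv_sub_two_piOp, sub_mulVec, dotProduct_sub, Matrix.smul_mulVec, dotProduct_smul,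
    delta2pi_quadForm, B9SectDFP.piOp_quadForm, smul_eq_mul]

end Pi

/-! ## §3. (3.136): Δ⁽²⁾A is the A-gradient of `⟨C⁽²⁾(A),H*J⟩ = ⟨HC⁽²⁾(A),J⟩` -/

/-- **(3.136), directional form**: for the quadratic form `q(A) = ⟨HC⁽²⁾(A),J⟩ = Aᵀ𝒞A`,
`d/dt q(A + tδA)|_{t=0} = ⟨δA, Δ⁽²⁾A⟩` — Δ⁽²⁾A is the gradient `(δ/δA)⟨C⁽²⁾(A),H*J⟩`; this is also the reading of the
pairing `⟨δA,Δ⁽²⁾A⟩` bounded in the display after (3.136). [cite: Balaban1985BackgroundPropagators, (3.136) p.422] -/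
theorem eq_3136_dir [Fintype b] (C : Matrix b b ℝ) (A δA : b → ℝ) :
    HasDerivAt (fun t : ℝ => (A + t • δA) ⬝ᵥ C *ᵥ (A + t • δA)) (δA ⬝ᵥ delta2 C *ᵥ A) 0 := by
  have hexp : (fun t : ℝ => (A + t • δA) ⬝ᵥ C *ᵥ (A + t • δA)) =
      fun t => A ⬝ᵥ C *ᵥ A + ((δA ⬝ᵥ C *ᵥ A + A ⬝ᵥ C *ᵥ δA) * t + (δA ⬝ᵥ C *ᵥ δA) * t ^ 2) := by
    funext t
    simp only [mulVec_add, mulVec_smul, dotProduct_add, add_dotProduct, dotProduct_smul, smul_dotProduct,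
      smul_eq_mul]
    ring
  have hval : δA ⬝ᵥ delta2 C *ᵥ A = δA ⬝ᵥ C *ᵥ A + A ⬝ᵥ C *ᵥ δA := by
    rw [delta2, add_mulVec, dotProduct_add, mulVec_transpose, dotProduct_comm δA (A ᵥ* C), ← dotProduct_mulVec]
  rw [hexp, hval]
  refine ((((hasDerivAt_id (0 : ℝ)).const_mul (δA ⬝ᵥ C *ᵥ A + A ⬝ᵥ C *ᵥ δA)).add
    (((hasDerivAt_id (0 : ℝ)).pow 2).const_mul (δA ⬝ᵥ C *ᵥ δA))).const_add (A ⬝ᵥ C *ᵥ A)).congr_deriv ?_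
  simp

/-- **(3.136), componentwise**: `(Δ⁽²⁾A)(b) = (δ/δA(b)) ⟨C⁽²⁾(A),H*J⟩` (the b-th partial derivative of `Aᵀ𝒞A`).
[cite: Balaban1985BackgroundPropagators, (3.136) p.422] -/
theorem eq_3136 [Fintype b] [DecidableEq b] (C : Matrix b b ℝ) (A : b → ℝ) (i : b) :
    (delta2 C *ᵥ A) i =
      deriv (fun t : ℝ => (A + t • Pi.single i 1) ⬝ᵥ C *ᵥ (A + t • Pi.single i 1)) 0 := by
  rw [(eq_3136_dir C A (Pi.single i 1)).deriv, single_one_dotProduct]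

/-- **(3.136), as the printed weighted sum**: when the form `⟨C⁽²⁾(A),H*J⟩ = Σ_j Σ_{b∈Λ_j} (L^jη)^{d+1}
tr[C_j⁽²⁾(A,b)(H*J)(b)]` is a weighted sum of bond terms `AᵀM_kA` (index k ↔ (j, b, component), weight
`w_k = (L^jη)^{d+1}`), `Δ⁽²⁾A = Σ_k w_k · ∇_A(AᵀM_kA)`, i.e. `Σ_j Σ_{b∈Λ_j} (L^jη)^{d+1} tr (δ/δA)C_j⁽²⁾(A,b)(H*J)(b)`.
[cite: Balaban1985BackgroundPropagators, (3.136) p.422] -/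
theorem eq_3136_sum [Fintype b] {β : Type*} (s : Finset β) (w : β → ℝ) (M : β → Matrix b b ℝ) (A : b → ℝ) :
    delta2 (∑ k ∈ s, w k • M k) *ᵥ A = ∑ k ∈ s, w k • (delta2 (M k) *ᵥ A) := by
  have hΔ : delta2 (∑ k ∈ s, w k • M k) = ∑ k ∈ s, w k • delta2 (M k) := by
    simp only [delta2, Matrix.transpose_sum, Matrix.transpose_smul, smul_add, Finset.sum_add_distrib]
  rw [hΔ, Matrix.sum_mulVec]
  refine Finset.sum_congr rfl fun k _ => ?_
  rw [Matrix.smul_mulVec]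

/-! ## §4. (3.137): the two printed bounds, typed over the multiscale geometry 𝔅 = ⋃Λ_j of [4] (`B6.Geometry`:
`g.len y = L^jη` for y ∈ Λ_j, `g.dist` = d(y,y′)), and the two printed "hence" steps -/

/-- **(3.137), first half** — the in-text estimate printed on p. 422 (last two lines, between the displays (3.136)
p. 422 and (3.137) p. 423), verbatim: *"From the regularity condition (3.36) and the inequality (3.133) we have
the estimate |(H\*J)(b)| ≤ O(1)Mα₀(L^jη)⁻³ for b ∈ Λ_j."* — typed shape: coarse bonds b indexed by their site y ∈ 𝔅
(`g.Site`, direction suppressed), `(L^jη) = g.len y`, `(H*J)(b) ↦ HJ y` (a size, e.g. the 𝔤-norm), O(1) ↦ `c`.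
[cite: Balaban1985BackgroundPropagators, (3.136)–(3.137) pp.422–423] -/
def Ineq3137a (g : B6.Geometry) (HJ : g.Site → ℝ) (c M α₀ : ℝ) : Prop :=
  ∀ y : g.Site, |HJ y| ≤ c * M * α₀ * (g.len y)⁻¹ ^ 3

/-- **(3.137), second half** p. 423 [PDF 35], verbatim: *"|(Δ⁽²⁾A)(b)| ≤ O(1)Mα₀(L^jη)⁻²|A|, b ∈ Δ(y), y ∈ Λ_j,
(3.137) and the supremum |A| is taken over several j-blocks surrounding Δ(y)."* — typed shape over the bond index `b` of
the Sect.-D carrier: `ℓ i = L^jη` (the scale of the block containing the bond i), `Asup i` = that local supremum of |A|.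
[cite: Balaban1985BackgroundPropagators, (3.137) p.423] -/
def Ineq3137b [Fintype b] (C : Matrix b b ℝ) (A : b → ℝ) (ℓ Asup : b → ℝ) (c M α₀ : ℝ) : Prop :=
  ∀ i : b, |(delta2 C *ᵥ A) i| ≤ c * M * α₀ * (ℓ i)⁻¹ ^ 2 * Asup i

/-- **The first "hence" of (3.137)** — `|(H*J)(b)| ≤ O(1)Mα₀(L^jη)⁻³` — PROVED from hypotheses of the printed shape:
`h3133` = (3.133) (`|H(x,y′)| ≤ O(1)(L^{j′}η)^{−d}e^{−½δ₁d(y,y′)}`, x ∈ Δ(y)) summed over the blocks Δ(y) of volume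
(L^{j}η)^d in the adjoint `(H*J)(b) = Σ_x η^d H(x,b)ᵀJ(x)`: `|(H*J)(b)| ≤ C_H Σ_y (L^{j_y}η)^d (L^jη)^{−d}
e^{−½δ₁d(y,b)} sup_{Δ(y)}|J|`; `h336` = (3.36) through (3.11) `J = D*η⁻²Im ∂U`: `sup_{Δ(y)}|J| ≤ c_J Mα₀(L^{j_y}η)⁻³`;
`h21` = the scale sum of [4] Lemma 2.1 ((2.60)–(2.61) with the p. 398 scale-transfer remark):
`Σ_y (L^{j_y}η)^{d−3} e^{−½δ₁d(y,b)} ≤ c₁(L^jη)^{d−3}`.  Conclusion: (3.137a) with O(1) = C_H·c_J·c₁.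
[cite: Balaban1985BackgroundPropagators, (3.136)–(3.137) pp.422–423] -/
theorem ineq3137a_of_3133_336 (g : B6.Geometry) (d : ℕ) (HJ Jsup : g.Site → ℝ) (CH cJ c₁ M α₀ δ₁ : ℝ)
    (hCH : 0 ≤ CH) (hcJM : 0 ≤ cJ * M * α₀) (hlen : ∀ y : g.Site, 0 < g.len y)
    (h3133 : ∀ y₀ : g.Site, |HJ y₀| ≤ CH * ∑ y : g.Site,
      g.len y ^ d * (g.len y₀)⁻¹ ^ d * Real.exp (-(δ₁ / 2) * g.dist y y₀) * Jsup y)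
    (h336 : ∀ y : g.Site, Jsup y ≤ cJ * M * α₀ * (g.len y)⁻¹ ^ 3)
    (h21 : ∀ y₀ : g.Site, ∑ y : g.Site, g.len y ^ d * (g.len y)⁻¹ ^ 3 * Real.exp (-(δ₁ / 2) * g.dist y y₀) ≤
      c₁ * (g.len y₀ ^ d * (g.len y₀)⁻¹ ^ 3)) :
    Ineq3137a g HJ (CH * cJ * c₁) M α₀ := by
  intro y₀
  have hl0 : 0 < g.len y₀ := hlen y₀
  -- insert (3.36) into the block sum of (3.133)
  have step1 : ∑ y : g.Site, g.len y ^ d * (g.len y₀)⁻¹ ^ d * Real.exp (-(δ₁ / 2) * g.dist y y₀) * Jsup y ≤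
      ∑ y : g.Site, g.len y ^ d * (g.len y₀)⁻¹ ^ d * Real.exp (-(δ₁ / 2) * g.dist y y₀) *
        (cJ * M * α₀ * (g.len y)⁻¹ ^ 3) := by
    refine Finset.sum_le_sum fun y _ => ?_
    have hw : 0 ≤ g.len y ^ d * (g.len y₀)⁻¹ ^ d * Real.exp (-(δ₁ / 2) * g.dist y y₀) :=
      mul_nonneg (mul_nonneg (pow_nonneg (hlen y).le _) (pow_nonneg (inv_nonneg.2 hl0.le) _))
        (Real.exp_pos _).le
    exact mul_le_mul_of_nonneg_left (h336 y) hw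
  -- pull the constants out and apply the Lemma-2.1 scale sum
  have step2 : ∑ y : g.Site, g.len y ^ d * (g.len y₀)⁻¹ ^ d * Real.exp (-(δ₁ / 2) * g.dist y y₀) *
        (cJ * M * α₀ * (g.len y)⁻¹ ^ 3) =
      cJ * M * α₀ * (g.len y₀)⁻¹ ^ d *
        ∑ y : g.Site, g.len y ^ d * (g.len y)⁻¹ ^ 3 * Real.exp (-(δ₁ / 2) * g.dist y y₀) := by
    rw [Finset.mul_sum]
    refine Finset.sum_congr rfl fun y _ => ?_
    ring
  have step3 : cJ * M * α₀ * (g.len y₀)⁻¹ ^ d *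
        ∑ y : g.Site, g.len y ^ d * (g.len y)⁻¹ ^ 3 * Real.exp (-(δ₁ / 2) * g.dist y y₀) ≤
      cJ * M * α₀ * (g.len y₀)⁻¹ ^ d * (c₁ * (g.len y₀ ^ d * (g.len y₀)⁻¹ ^ 3)) :=
    mul_le_mul_of_nonneg_left (h21 y₀) (mul_nonneg hcJM (pow_nonneg (inv_nonneg.2 hl0.le) _))
  have hpow : (g.len y₀)⁻¹ ^ d * g.len y₀ ^ d = 1 := by
    rw [← mul_pow, inv_mul_cancel₀ hl0.ne', one_pow]
  calc |HJ y₀| ≤ CH * ∑ y : g.Site,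
        g.len y ^ d * (g.len y₀)⁻¹ ^ d * Real.exp (-(δ₁ / 2) * g.dist y y₀) * Jsup y := h3133 y₀
    _ ≤ CH * (cJ * M * α₀ * (g.len y₀)⁻¹ ^ d * (c₁ * (g.len y₀ ^ d * (g.len y₀)⁻¹ ^ 3))) := by
        refine mul_le_mul_of_nonneg_left ?_ hCH
        exact step1.trans (step2 ▸ step3)
    _ = CH * cJ * c₁ * M * α₀ * (g.len y₀)⁻¹ ^ 3 := by
        linear_combination CH * cJ * M * α₀ * c₁ * (g.len y₀)⁻¹ ^ 3 * hpow

/-- **The second "hence" of (3.137)** — from the displayed consequence of [5] (149), `|⟨δA,Δ⁽²⁾A⟩| ≤ O(1)C₃Mα₀ Σ_j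
Σ_{b∈Λ_j} (L^jη)^{d−2}(Q″_j|δA|)(c)|A|_c` (typed shape over the bond index of the carrier, the pairing weights absorbed
into `⬝ᵥ` as everywhere in `B9SectDFP`: `|⟨δA,Δ⁽²⁾A⟩| ≤ Σ_i O(1)Mα₀(L^jη)⁻²|A|_i·|δA(i)|`), to the pointwise bound
`|(Δ⁽²⁾A)(b)| ≤ O(1)Mα₀(L^jη)⁻²|A|`: test against the unit bond configuration `δA = e_b`.
[cite: Balaban1985BackgroundPropagators, (3.137) p.423] -/
theorem ineq3137b_of_149 [Fintype b] [DecidableEq b] (C : Matrix b b ℝ) (A : b → ℝ) (ℓ Asup : b → ℝ)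
    (c M α₀ : ℝ)
    (h149 : ∀ δA : b → ℝ, |δA ⬝ᵥ delta2 C *ᵥ A| ≤ ∑ i : b, c * M * α₀ * (ℓ i)⁻¹ ^ 2 * Asup i * |δA i|) :
    Ineq3137b C A ℓ Asup c M α₀ := by
  intro i
  have h := h149 (Pi.single i 1)
  rw [single_one_dotProduct] at h
  refine h.trans (le_of_eq ?_)
  rw [Finset.sum_eq_single i]
  · simp
  · intro k _ hk
    simp [hk]
  · intro hi
    exact absurd (Finset.mem_univ i) hi

end

end Literature.MathematicalPhysics.QuantumFieldTheory.Balaban1983to89.B9Delta2Def134
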